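import Mathlib
import HarnessLib
import Summits.Ventures.LatticeQCDFlow.Exactness.TransformedHMC
import Summits.Ventures.LatticeQCDFlow.Exactness.CircleGroupJacobian

/-!
# Every increasing degree-one lift is a measurable equivalence of U(1) with jointly measurable inverse: FT-HMC is exact for ALL `C¹` U(1) coupling layers

HONEST FRAMING: exact (Metropolis-corrected) sampling algorithms for lattice gauge theory;
figures of merit are autocorrelation/cost numbers at stated couplings and volumes; no
continuum-physics claim.

Venture `LatticeQCDFlow` (cell pub-lqcd), topic `Exactness`; FANOUT row 14 (`eng-flowhmc`, engine
`latflow.fthmc`).  NEW WORK of the cell over Mathlib and the tree's `TransformedHMC`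
(`thmc_hmc_exact`, row 7), `Scaling/EntropyBudgetCoupling` (`Theory2.coupleEquiv`,
`hasJacobian_coupleFun`, row 31), `CircleGroupJacobian` (row 14).  Nothing is cited as a fact.
Printed counterparts, named only: Lüscher 2010 §2 (HMC for the pulled-back action needs the
field transformation to be a BIJECTION; its inverse is never evaluated by the algorithm but must
exist measurably for the reported chain to be a Markov chain on the target space), Kanwar et
al. 2020, Rezende et al. 2020 (flows on tori: active angles moved by increasing degree-one maps).

`U1MaskedLayerEquiv.lean` made the engine's sin-sum layer a measurable equivalence of `ι → U(1)` by
showing that its Banach fixed-point inverse is jointly measurable (limit of explicit iterates).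
That argument was specific to the contraction.  Here the inverse of ANY strictly increasing
surjective lift, measurably parametrised, is shown jointly measurable by one order-theoretic
remark — `{Φ_e⁻¹(u) < x} = {u < Φ_e(x)}` — so every `C¹` degree-one U(1) coupling layer of the cell
(the NTHMC / Wilson-flow class AND the NCP class of rows 3 / 4, i.e. the engine's
`u1-flow-trained` member, instantiated in `NCPLayerEquiv.lean`) is a measurable equivalence of the
gauge-field space, and `thmc_hmc_exact` applies to it with every hypothesis discharged.

## Content

* `degreeOne_add_int_mul_two_pi`, `surjective_of_degreeOne` (a continuous degree-one lift is
  onto), `orderIso_symm_add_two_pi` (the inverse lift has degree one);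
* **`measurable_orderIso_symm_prod`** — for a family `Φ e : ℝ → ℝ` (any measurable parameter
  space) of strictly increasing surjections with `e ↦ Φ e x` measurable for every `x`, the inverse
  family `(u, e) ↦ (Φ e)⁻¹ u` is jointly measurable (`measurable_of_Iio`);
* `exists_measurableEquiv_circle_of_lifts` (two mutually inverse measurable degree-one lifts
  descend to `ψ : U(1) ≃ᵐ U(1)`), **`exists_measurableEquiv_circle_of_degreeOne`** (any
  continuous strictly increasing degree-one lift does, with `ψ⁻¹ (e^{iu}) = e^{iΦ⁻¹(u)}`),
  **`exists_coupleEquiv_of_degreeOne`** / `exists_coupleEquiv_of_hasDerivAt_pos` (families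
  jointly measurable in (link, frozen links): single-link equivalences whose forward AND inverse
  maps are jointly measurable = the hypotheses of `Theory2.coupleEquiv`);
* **`thmc_hmc_exact_coupleEquiv_of_degreeOne`** — FT-HMC through ANY U(1) coupling layer whose
  active links move by `C¹` degree-one lifts with positive derivative, jointly measurable in the
  frozen links, is exact: for any measurable action `S`, kinetic term `T`, momenta space
  `(P, volP)` and any measurable `Haar^ι ⊗ volP`-preserving involution `Θ` of phase space, the
  kernel for `H̃ = S ∘ F − log J + T` (`J = coupleJac = ∏_active Φ'`) reported through `F × id`
  leaves `e^{−(S+T)} · Haar^ι ⊗ volP` invariant.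

NOT here: momentum refresh / ergodicity (as in `TransformedHMC`); SU(N) (needs the Haar volume
form on `SU(N)`, not in Mathlib); any number.
-/

noncomputable section

namespace Summit.Ventures.LatticeQCDFlow.Exactness

open Real Set Function MeasureTheory Filter Summit.Ventures.LatticeQCDFlow.Theory2
open ProbabilityTheory ProbabilityTheory.Kernel
open Literature.MathematicalPhysics.QuantumFieldTheory (haarProbability)
open scoped NNReal ENNReal Topology

/-! ## Degree-one lifts: integer shifts, surjectivity, the inverse lift -/

section Lift

variable {Φ : ℝ → ℝ}

/-- A degree-one lift commutes with every integer multiple of `2π`: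
`Φ (θ + k·2π) = Φ θ + k·2π`. -/
theorem degreeOne_add_int_mul_two_pi (hdeg : ∀ θ, Φ (θ + 2 * π) = Φ θ + 2 * π) (θ : ℝ)
    (k : ℤ) : Φ (θ + k * (2 * π)) = Φ θ + k * (2 * π) := by
  have hper : Function.Periodic (fun θ => Φ θ - θ) (2 * π) := fun θ => by
    show Φ (θ + 2 * π) - (θ + 2 * π) = Φ θ - θ
    rw [hdeg]
    ring
  have h : Φ (θ + k * (2 * π)) - (θ + k * (2 * π)) = Φ θ - θ := hper.int_mul k θ
  linarith

/-- **A continuous degree-one lift is surjective** (it is unbounded in both directions). -/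
theorem surjective_of_degreeOne (hcont : Continuous Φ)
    (hdeg : ∀ θ, Φ (θ + 2 * π) = Φ θ + 2 * π) : Function.Surjective Φ := by
  intro u
  obtain ⟨n, hn⟩ := exists_nat_ge ((u - Φ 0) / (2 * π))
  obtain ⟨m, hm⟩ := exists_nat_ge ((Φ 0 - u) / (2 * π))
  have hn' : u - Φ 0 ≤ n * (2 * π) := by rwa [div_le_iff₀ two_pi_pos] at hn
  have hm' : Φ 0 - u ≤ m * (2 * π) := by rwa [div_le_iff₀ two_pi_pos] at hm
  refine mem_range_of_exists_le_of_exists_ge hcont ⟨0 + ((-(m : ℤ) : ℤ) : ℝ) * (2 * π), ?_⟩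
    ⟨0 + ((n : ℤ) : ℝ) * (2 * π), ?_⟩
  · rw [degreeOne_add_int_mul_two_pi hdeg]
    push_cast
    linarith
  · rw [degreeOne_add_int_mul_two_pi hdeg]
    push_cast
    linarith

/-- **The inverse lift has degree one**: for a strictly increasing surjective degree-one lift
`Φ` with inverse `Φ⁻¹` (the order isomorphism `StrictMono.orderIsoOfSurjective`),
`Φ⁻¹ (u + 2π) = Φ⁻¹ u + 2π`. -/
theorem orderIso_symm_add_two_pi (hmono : StrictMono Φ) (hsurj : Function.Surjective Φ)
    (hdeg : ∀ θ, Φ (θ + 2 * π) = Φ θ + 2 * π) (u : ℝ) :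
    (hmono.orderIsoOfSurjective Φ hsurj).symm (u + 2 * π) =
      (hmono.orderIsoOfSurjective Φ hsurj).symm u + 2 * π := by
  apply hmono.injective
  rw [StrictMono.orderIsoOfSurjective_self_symm_apply Φ hmono hsurj, hdeg,
    StrictMono.orderIsoOfSurjective_self_symm_apply Φ hmono hsurj]

end Lift

/-! ## Joint measurability of the inverse of a measurably parametrised increasing bijection -/

/-- **Inverses of measurably parametrised increasing bijections are jointly measurable.**  For a
family `Φ e : ℝ → ℝ` (`e` in any measurable space) of strictly increasing surjections with
`e ↦ Φ e x` measurable for every `x`, the map `(u, e) ↦ (Φ e)⁻¹ u` is measurable: its sub-level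
sets are `{(u, e) | (Φ e)⁻¹ u < x} = {(u, e) | u < Φ e x}`. -/
theorem measurable_orderIso_symm_prod {E : Type*} [MeasurableSpace E] {Φ : E → ℝ → ℝ}
    (hmono : ∀ e, StrictMono (Φ e)) (hsurj : ∀ e, Function.Surjective (Φ e))
    (hmeas : ∀ x : ℝ, Measurable fun e => Φ e x) :
    Measurable fun w : ℝ × E =>
      ((hmono w.2).orderIsoOfSurjective (Φ w.2) (hsurj w.2)).symm w.1 := by
  refine measurable_of_Iio fun x => ?_
  have hset : (fun w : ℝ × E =>
      ((hmono w.2).orderIsoOfSurjective (Φ w.2) (hsurj w.2)).symm w.1) ⁻¹' Iio x =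
        {w : ℝ × E | w.1 < Φ w.2 x} := by
    ext w
    simp only [mem_preimage, mem_Iio, mem_setOf_eq, OrderIso.symm_apply_lt,
      StrictMono.coe_orderIsoOfSurjective]
  rw [hset]
  exact measurableSet_lt measurable_fst ((hmeas x).comp measurable_snd)

/-! ## Degree-one lifts descend to measurable equivalences of `U(1)` -/

section Equiv

/-- **Two mutually inverse measurable degree-one lifts descend to a measurable equivalence of
`U(1)`**: `ψ (e^{iθ}) = e^{iΦ θ}`, `ψ⁻¹ (e^{iu}) = e^{iΨ u}` (both maps are periodic lifts through
`ℝ/2πℤ ≃ᵐ U(1)`; their values involve no choice). -/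
theorem exists_measurableEquiv_circle_of_lifts {Φ Ψ : ℝ → ℝ} (hΦm : Measurable Φ)
    (hΨm : Measurable Ψ) (hΦdeg : ∀ θ, Φ (θ + 2 * π) = Φ θ + 2 * π)
    (hΨdeg : ∀ u, Ψ (u + 2 * π) = Ψ u + 2 * π) (hΨΦ : ∀ θ, Ψ (Φ θ) = θ)
    (hΦΨ : ∀ u, Φ (Ψ u) = u) :
    ∃ ψ : Circle ≃ᵐ Circle,
      (∀ θ : ℝ, ψ (Circle.exp θ) = Circle.exp (Φ θ)) ∧
      (∀ u : ℝ, ψ.symm (Circle.exp u) = Circle.exp (Ψ u)) := by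
  -- the forward / backward lifts `θ ↦ e^{iΦ θ}`, `u ↦ e^{iΨ u}` are `2π`-periodic
  have hF₀ : Function.Periodic (fun θ : ℝ => Circle.exp (Φ θ)) (2 * π) := fun θ => by
    simp only
    rw [hΦdeg, Circle.exp_add, Circle.exp_two_pi, mul_one]
  have hG₀ : Function.Periodic (fun u : ℝ => Circle.exp (Ψ u)) (2 * π) := fun u => by
    simp only
    rw [hΨdeg, Circle.exp_add, Circle.exp_two_pi, mul_one]
  -- pulling back along `ℝ/2πℤ ≃ᵐ U(1)`
  have hEsymm : ∀ θ : ℝ, (Homeomorph.toMeasurableEquiv AddCircle.homeomorphCircle' :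
        AddCircle (2 * π) ≃ᵐ Circle).symm (Circle.exp θ) = (θ : AddCircle (2 * π)) := fun θ => by
    rw [← coe_circleEquiv_apply_coe, MeasurableEquiv.symm_apply_apply]
  have keyF : ∀ θ : ℝ, hF₀.lift ((Homeomorph.toMeasurableEquiv AddCircle.homeomorphCircle' :
        AddCircle (2 * π) ≃ᵐ Circle).symm (Circle.exp θ)) = Circle.exp (Φ θ) := fun θ => by
    rw [hEsymm, Function.Periodic.lift_coe]
  have keyG : ∀ u : ℝ, hG₀.lift ((Homeomorph.toMeasurableEquiv AddCircle.homeomorphCircle' :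
        AddCircle (2 * π) ≃ᵐ Circle).symm (Circle.exp u)) = Circle.exp (Ψ u) := fun u => by
    rw [hEsymm, Function.Periodic.lift_coe]
  have hmf : Measurable fun g : Circle => hF₀.lift ((Homeomorph.toMeasurableEquiv
      AddCircle.homeomorphCircle' : AddCircle (2 * π) ≃ᵐ Circle).symm g) :=
    Circle.measurable_of_measurable_comp_exp (by
      simp_rw [keyF]
      exact Circle.exp.continuous.measurable.comp hΦm)
  have hmb : Measurable fun g : Circle => hG₀.lift ((Homeomorph.toMeasurableEquiv
      AddCircle.homeomorphCircle' : AddCircle (2 * π) ≃ᵐ Circle).symm g) :=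
    Circle.measurable_of_measurable_comp_exp (by
      simp_rw [keyG]
      exact Circle.exp.continuous.measurable.comp hΨm)
  refine ⟨{ toFun := fun g => hF₀.lift ((Homeomorph.toMeasurableEquiv AddCircle.homeomorphCircle' :
        AddCircle (2 * π) ≃ᵐ Circle).symm g)
            invFun := fun g => hG₀.lift ((Homeomorph.toMeasurableEquiv AddCircle.homeomorphCircle' :
        AddCircle (2 * π) ≃ᵐ Circle).symm g)
            left_inv := fun g => ?_
            right_inv := fun g => ?_
            measurable_toFun := hmf
            measurable_invFun := hmb }, fun θ => keyF θ, fun u => keyG u⟩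
  · -- `ψ⁻¹ (ψ g) = g`
    obtain ⟨θ, rfl⟩ := Circle.exp_surjective g
    simp only
    rw [keyF, keyG, hΨΦ]
  · -- `ψ (ψ⁻¹ g) = g`
    obtain ⟨u, rfl⟩ := Circle.exp_surjective g
    simp only
    rw [keyG, keyF, hΦΨ]

variable {Φ : ℝ → ℝ}

/-- **Any continuous strictly increasing degree-one lift is a measurable equivalence of `U(1)`**,
`ψ (e^{iθ}) = e^{iΦ θ}`, with inverse `ψ⁻¹ (e^{iu}) = e^{iΦ⁻¹ u}` given by the inverse lift. -/
theorem exists_measurableEquiv_circle_of_degreeOne (hcont : Continuous Φ) (hmono : StrictMono Φ)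
    (hdeg : ∀ θ, Φ (θ + 2 * π) = Φ θ + 2 * π) :
    ∃ ψ : Circle ≃ᵐ Circle,
      (∀ θ : ℝ, ψ (Circle.exp θ) = Circle.exp (Φ θ)) ∧
      (∀ u : ℝ, ψ.symm (Circle.exp u) = Circle.exp
        ((hmono.orderIsoOfSurjective Φ (surjective_of_degreeOne hcont hdeg)).symm u)) :=
  exists_measurableEquiv_circle_of_lifts hcont.measurable
    (hmono.orderIsoOfSurjective Φ (surjective_of_degreeOne hcont hdeg)).symm.continuous.measurable
    hdeg (orderIso_symm_add_two_pi hmono _ hdeg)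
    (StrictMono.orderIsoOfSurjective_symm_apply_self Φ hmono _)
    (StrictMono.orderIsoOfSurjective_self_symm_apply Φ hmono _)

end Equiv

/-! ## Families: coupling layers of degree-one lifts as measurable equivalences of `ι → U(1)` -/

section Family

variable {ι : Type*} {p : ι → Prop}

/-- **Coupling layers of degree-one lifts are measurable equivalences of the gauge-field space.**
Active link `a`, frozen links `y : {i // ¬ p i} → U(1)`, lifts `Φ a y` continuous, strictly
increasing, of degree one and jointly measurable in `(θ, y)`: there is a family of single-link
measurable equivalences `ψ a y : U(1) ≃ᵐ U(1)` with `ψ a y (e^{iθ}) = e^{iΦ a y θ}` and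
`(ψ a y)⁻¹ (e^{iu}) = e^{i(Φ a y)⁻¹ u}` whose forward AND inverse maps are jointly measurable in
(link, frozen links) — the hypotheses of row 31's `Theory2.coupleEquiv`. -/
theorem exists_coupleEquiv_of_degreeOne {Φ : {i // p i} → ({i // ¬p i} → Circle) → ℝ → ℝ}
    (hcont : ∀ a y, Continuous (Φ a y)) (hmono : ∀ a y, StrictMono (Φ a y))
    (hdeg : ∀ a y θ, Φ a y (θ + 2 * π) = Φ a y θ + 2 * π)
    (hΦm : ∀ a, Measurable fun w : ℝ × ({i // ¬p i} → Circle) => Φ a w.2 w.1) :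
    ∃ ψ : {i // p i} → ({i // ¬p i} → Circle) → Circle ≃ᵐ Circle,
      (∀ a y (θ : ℝ), ψ a y (Circle.exp θ) = Circle.exp (Φ a y θ)) ∧
      (∀ a y (u : ℝ), (ψ a y).symm (Circle.exp u) = Circle.exp
        (((hmono a y).orderIsoOfSurjective (Φ a y)
          (surjective_of_degreeOne (hcont a y) (hdeg a y))).symm u)) ∧
      (∀ a, Measurable fun q : Circle × ({i // ¬p i} → Circle) => ψ a q.2 q.1) ∧
      (∀ a, Measurable fun q : Circle × ({i // ¬p i} → Circle) => (ψ a q.2).symm q.1) := by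
  choose ψ hψ hψs using fun a y =>
    exists_measurableEquiv_circle_of_degreeOne (hcont a y) (hmono a y) (hdeg a y)
  refine ⟨ψ, hψ, hψs, fun a => ?_, fun a => ?_⟩
  · refine Circle.measurable_of_measurable_comp_exp_prod ?_
    simp_rw [hψ]
    exact Circle.exp.continuous.measurable.comp (hΦm a)
  · refine Circle.measurable_of_measurable_comp_exp_prod ?_
    simp_rw [hψs]
    refine Circle.exp.continuous.measurable.comp
      (measurable_orderIso_symm_prod (hmono a)
        (fun y => surjective_of_degreeOne (hcont a y) (hdeg a y)) fun x => ?_)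
    exact (hΦm a).comp ((measurable_const (a := x)).prodMk measurable_id)

/-- The same from the three calculus facts of a `C¹` lift (`Φ'> 0` gives strict monotonicity,
the derivative gives continuity): the form consumed by the FT-HMC theorem below. -/
theorem exists_coupleEquiv_of_hasDerivAt_pos
    {Φ Φ' : {i // p i} → ({i // ¬p i} → Circle) → ℝ → ℝ}
    (hderiv : ∀ a y θ, HasDerivAt (Φ a y) (Φ' a y θ) θ) (hpos : ∀ a y θ, 0 < Φ' a y θ)
    (hdeg : ∀ a y θ, Φ a y (θ + 2 * π) = Φ a y θ + 2 * π)
    (hΦm : ∀ a, Measurable fun w : ℝ × ({i // ¬p i} → Circle) => Φ a w.2 w.1) :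
    ∃ ψ : {i // p i} → ({i // ¬p i} → Circle) → Circle ≃ᵐ Circle,
      (∀ a y (θ : ℝ), ψ a y (Circle.exp θ) = Circle.exp (Φ a y θ)) ∧
      (∀ a, Measurable fun q : Circle × ({i // ¬p i} → Circle) => ψ a q.2 q.1) ∧
      (∀ a, Measurable fun q : Circle × ({i // ¬p i} → Circle) => (ψ a q.2).symm q.1) := by
  obtain ⟨ψ, hψ, -, hψm, hψsm⟩ := exists_coupleEquiv_of_degreeOne
    (fun a y => continuous_of_hasDerivAt' (hderiv a y))
    (fun a y => strictMono_of_hasDerivAt_pos (hderiv a y) (hpos a y)) hdeg hΦm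
  exact ⟨ψ, hψ, hψm, hψsm⟩

end Family

/-! ## FT-HMC through any `C¹` degree-one U(1) coupling layer is exact -/

section THMC

variable {ι : Type*} [Fintype ι] {p : ι → Prop} [DecidablePred p]
  {P : Type*} [MeasurableSpace P] {volP : Measure P} [SFinite volP]

/-- **FT-HMC through any `C¹` degree-one U(1) coupling layer is exact.**  Links `ι → U(1)` with
the product Haar probability measure, momenta in any `(P, volP)`; lifts `Φ a y` with derivative
`Φ' a y` (`C¹`, positive, degree one, jointly measurable in `(θ, y)` together with `Φ'`); the
layer `F = coupleEquiv ψ …` with `ψ a y (e^{iθ}) = e^{iΦ a y θ}` (any such family, e.g. the one of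
`exists_coupleEquiv_of_hasDerivAt_pos`) and Jacobian `J = coupleJac p jac`,
`jac a y (e^{iθ}) = Φ' a y θ`; ANY measurable action `S`, kinetic term `T` and measurable
`Haar^ι ⊗ volP`-preserving involution `Θ` of phase space.  Then the HMC kernel for
`H̃(V, π) = (S (F V) − log J(V)) + T(π)` reported through `F × id` leaves
`e^{−(S + T)} · Haar^ι ⊗ volP` invariant. -/
theorem thmc_hmc_exact_coupleEquiv_of_degreeOne
    {Φ Φ' : {i // p i} → ({i // ¬p i} → Circle) → ℝ → ℝ}
    (hderiv : ∀ a y θ, HasDerivAt (Φ a y) (Φ' a y θ) θ) (hcont : ∀ a y, Continuous (Φ' a y))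
    (hpos : ∀ a y θ, 0 < Φ' a y θ) (hdeg : ∀ a y θ, Φ a y (θ + 2 * π) = Φ a y θ + 2 * π)
    (hΦm : ∀ a, Measurable fun w : ℝ × ({i // ¬p i} → Circle) => Φ a w.2 w.1)
    (hΦ'm : ∀ a, Measurable fun w : ℝ × ({i // ¬p i} → Circle) => Φ' a w.2 w.1)
    (ψ : {i // p i} → ({i // ¬p i} → Circle) → Circle ≃ᵐ Circle)
    (hψ : ∀ a y (θ : ℝ), ψ a y (Circle.exp θ) = Circle.exp (Φ a y θ))
    (hψm : ∀ a, Measurable fun q : Circle × ({i // ¬p i} → Circle) => ψ a q.2 q.1)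
    (hψsm : ∀ a, Measurable fun q : Circle × ({i // ¬p i} → Circle) => (ψ a q.2).symm q.1)
    {jac : {i // p i} → ({i // ¬p i} → Circle) → Circle → ℝ}
    (hjac : ∀ a y (θ : ℝ), jac a y (Circle.exp θ) = Φ' a y θ)
    {S : (ι → Circle) → ℝ} (hS : Measurable S) {T : P → ℝ} (hT : Measurable T)
    {Θ : (ι → Circle) × P → (ι → Circle) × P} {hΘ : Measurable Θ} (hinv : Function.Involutive Θ)
    (hvol : MeasurePreserving Θ
      ((Measure.pi fun _ : ι => haarProbability Circle).prod volP)
      ((Measure.pi fun _ : ι => haarProbability Circle).prod volP)) :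
    Invariant
      (conjKernel (involMH Θ hΘ fun z : (ι → Circle) × P =>
          (S (coupleEquiv ψ hψm hψsm z.1) - Real.log (coupleJac p jac z.1)) + T z.2)
        ((coupleEquiv ψ hψm hψsm).prodCongr (MeasurableEquiv.refl P)))
      (((Measure.pi fun _ : ι => haarProbability Circle).prod volP).withDensity
        fun z => ENNReal.ofReal (Real.exp (-(S z.1 + T z.2)))) := by
  -- per-link factor: positive at every point of `U(1)`, jointly measurable
  have hj0 : ∀ a y g, 0 < jac a y g := fun a y g => by
    obtain ⟨θ, rfl⟩ := Circle.exp_surjective g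
    rw [hjac]
    exact hpos a y θ
  have hjm : ∀ a, Measurable fun q : Circle × ({i // ¬p i} → Circle) => jac a q.2 q.1 := fun a => by
    refine Circle.measurable_of_measurable_comp_exp_prod ?_
    simp_rw [hjac]
    exact hΦ'm a
  have hF : HasJacobian (Measure.pi fun _ : ι => haarProbability Circle)
      (coupleEquiv ψ hψm hψsm) fun U => ENNReal.ofReal (coupleJac p jac U) :=
    hasJacobian_coupleFun_circleGroup_of_degreeOne hderiv hcont hpos hdeg hΦm hΦ'm
      (ψ := fun a y g => ψ a y g) hψ hjac
  exact thmc_hmc_exact (F := coupleEquiv ψ hψm hψsm) (J := coupleJac p jac)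
    (fun U => coupleJac_pos hj0 U) (measurable_coupleJac hjm) hF hS hT hinv hvol

end THMC

end Summit.Ventures.LatticeQCDFlow.Exactness
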